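import Mathlib.AlgebraicGeometry.ResidueField
import Mathlib.AlgebraicGeometry.Cover.Open
import Mathlib.CategoryTheory.Subfunctor.Basic
import HarnessLib

/-!
# Pointwise open conditions on a functor of points

Topic: `Literature/AlgebraicGeometry/Motives` (functor-of-points infrastructure). The open
subfunctors met in practice (standard charts of Grassmannians and projective spaces, loci where
a map of finite locally free sheaves is surjective, …) are cut out POINTWISE: a `T`-point `y` of
`F` lies in the subfunctor `P` iff all its field-valued specialisations
`κ(p) → T → F`, `p ∈ T`, do, and membership of a field-valued point is unchanged under field
extensions. For such `P` the open-condition data consumed by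
`Literature.AlgebraicGeometry.Motives.isOpenImmersion_presheaf_of_openCondition`
(`OpenSubfunctorCover`) is automatic: with `U_x := {p ∈ T | x(p) ∈ P}`,

* `map_mem_iff_range_subset_of_pointwise` — `h^*x ∈ P(T′) ↔ h(T′) ⊆ U_x` for every `h : T′ → T`
  (Görtz–Wedhorn (8.4): the pullback of an open subfunctor to `h_T` is the open subscheme `U_x`).
* `openCondition_of_pointwise` — the same packaged as the `(U : F(T) → T.Opens, hU)` data.
* `map_fromSpecResidueField_mem_iff_of_isIso` / `isOpen_setOf_pointwise_of_openCover` — the locus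
  `U_x` is compatible with open immersions, so its openness is local on `T` (check it on an
  affine open cover, where it is a `D(I)` by the Fitting-ideal criterion
  `Literature.RingTheory.FittingIdeal.LinearMap.isOpen_setOf_surjective_baseChange_residueField`).
* `iUnion_setOf_pointwise_eq_univ` — a cover of the field-valued points covers every `T`.

## Sources

* U. Görtz, T. Wedhorn, *Algebraic Geometry I* (2nd ed. 2020), Ch. 8, (8.3)–(8.4) (open
  subfunctors, Zariski coverings of functors) and Lemma 8.13 (the Grassmannian charts).
* A. Grothendieck, J. Dieudonné, *EGA I* (1971), Ch. 0, 4.5.4.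
-/

namespace Literature.AlgebraicGeometry.Motives

universe u

open CategoryTheory Opposite _root_.AlgebraicGeometry

variable {F : Scheme.{u}ᵒᵖ ⥤ Type u} (P : Subfunctor F)

/-- **Field-valued points of a pullback**: for `x ∈ F(T)`, `h : T′ → T` and `p′ ∈ T′`, the value
of `h^*x` at `p′` is the pullback along `Spec κ(p′) → Spec κ(h p′)` of the value of `x` at `h p′`
(naturality of `fromSpecResidueField`, Mathlib
`Scheme.Hom.SpecMap_residueFieldMap_fromSpecResidueField`). [cite: GortzWedhorn2020, Ch. 8 (8.4)] -/
theorem map_fromSpecResidueField_comp {T T' : Scheme.{u}} (x : F.obj (op T)) (h : T' ⟶ T)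
    (p' : T') :
    F.map (T'.fromSpecResidueField p').op (F.map h.op x) =
      F.map (Spec.map (h.residueFieldMap p')).op
        (F.map (T.fromSpecResidueField (h p')).op x) := by
  rw [← Functor.map_comp_apply, ← Functor.map_comp_apply, ← op_comp, ← op_comp,
    Scheme.Hom.SpecMap_residueFieldMap_fromSpecResidueField]

/-- **Pointwise open conditions define open-condition data** (Görtz–Wedhorn (8.4)): let
`P ⊆ F` be a subfunctor of a functor of points such that (pt) membership is tested on
field-valued points — `y ∈ P(T) ↔ y(p) ∈ P(Spec κ(p))` for all `p ∈ T` — and (refl) membership of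
a field-valued point is reflected along field extensions `Spec L → Spec K`. Then for every
`x ∈ F(T)` and `h : T′ → T`: `h^*x ∈ P(T′)` iff `h(T′)` lies in the locus
`U_x = {p | x(p) ∈ P}`. [cite: GortzWedhorn2020, Ch. 8 (8.4)] -/
theorem map_mem_iff_range_subset_of_pointwise
    (hpt : ∀ {T : Scheme.{u}} (y : F.obj (op T)),
      y ∈ P.obj (op T) ↔
        ∀ p : T, F.map (T.fromSpecResidueField p).op y ∈ P.obj (op (Spec (T.residueField p))))
    (hrefl : ∀ (K L : CommRingCat.{u}) (_ : IsField K) (_ : IsField L) (φ : K ⟶ L)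
      (y : F.obj (op (Spec K))), F.map (Spec.map φ).op y ∈ P.obj (op (Spec L)) →
        y ∈ P.obj (op (Spec K)))
    {T : Scheme.{u}} (x : F.obj (op T)) (U : Set T)
    (hU : ∀ p : T, p ∈ U ↔ F.map (T.fromSpecResidueField p).op x ∈ P.obj (op (Spec (T.residueField p))))
    {T' : Scheme.{u}} (h : T' ⟶ T) :
    F.map h.op x ∈ P.obj (op T') ↔ Set.range h ⊆ U := by
  constructor
  · intro hx
    rintro _ ⟨p', rfl⟩
    rw [hU]
    have h1 := (hpt _).mp hx p'
    rw [map_fromSpecResidueField_comp] at h1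
    exact hrefl _ _ (Field.toIsField _) (Field.toIsField _) _ _ h1
  · intro hsub
    refine (hpt _).mpr fun p' => ?_
    rw [map_fromSpecResidueField_comp]
    exact P.map _ ((hU (h p')).mp (hsub ⟨p', rfl⟩))

/-- **The pointwise locus is compatible with open immersions** (indeed with any morphism inducing
isomorphisms on residue fields): for an open immersion `j : V → T` and `q ∈ V`,
`(j^*x)(q) ∈ P ↔ x(j q) ∈ P`. [cite: GortzWedhorn2020, Ch. 8 (8.4)] -/
theorem map_fromSpecResidueField_mem_iff_of_isIso {T V : Scheme.{u}} (x : F.obj (op T))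
    (j : V ⟶ T) (q : V) [IsIso (j.residueFieldMap q)] :
    F.map (V.fromSpecResidueField q).op (F.map j.op x) ∈ P.obj (op (Spec (V.residueField q))) ↔
      F.map (T.fromSpecResidueField (j q)).op x ∈ P.obj (op (Spec (T.residueField (j q)))) := by
  have key := map_fromSpecResidueField_comp (F := F) x j q
  constructor
  · intro hq
    rw [key] at hq
    have h2 : F.map (Spec.map (inv (j.residueFieldMap q))).op
        (F.map (Spec.map (j.residueFieldMap q)).op
          (F.map (T.fromSpecResidueField (j q)).op x)) ∈
        P.obj (op (Spec (T.residueField (j q)))) := P.map _ hq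
    rwa [← Functor.map_comp_apply, ← op_comp, ← Spec.map_comp, IsIso.hom_inv_id, Spec.map_id,
      op_id, F.map_id, types_id_apply] at h2
  · intro hq
    rw [key]
    exact P.map _ hq

/-- **Openness of the pointwise locus is local on `T`**: if for an open cover `𝒰` of `T` the
loci of the restrictions `x|_{𝒰ᵢ}` are open in `𝒰ᵢ`, then the locus of `x` is open in `T` (the
locus meets `𝒰ᵢ` in the image of the locus of `x|_{𝒰ᵢ}`). Typical use: affine cover + the
Fitting-ideal description of the locus on affines. [cite: GortzWedhorn2020, Ch. 8 (8.4)] -/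
theorem isOpen_setOf_pointwise_of_openCover {T : Scheme.{u}} (x : F.obj (op T)) (𝒰 : T.OpenCover)
    (h𝒰 : ∀ i, IsOpen {q : 𝒰.X i | F.map ((𝒰.X i).fromSpecResidueField q).op
      (F.map (𝒰.f i).op x) ∈ P.obj (op (Spec ((𝒰.X i).residueField q)))}) :
    IsOpen {p : T | F.map (T.fromSpecResidueField p).op x ∈
      P.obj (op (Spec (T.residueField p)))} := by
  rw [isOpen_iff_forall_mem_open]
  intro p hp
  obtain ⟨i, q, rfl⟩ := 𝒰.exists_eq p
  refine ⟨(𝒰.f i) '' {q : 𝒰.X i | F.map ((𝒰.X i).fromSpecResidueField q).op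
      (F.map (𝒰.f i).op x) ∈ P.obj (op (Spec ((𝒰.X i).residueField q)))}, ?_, ?_, ?_⟩
  · rintro _ ⟨q', hq', rfl⟩
    exact (map_fromSpecResidueField_mem_iff_of_isIso P x (𝒰.f i) q').mp hq'
  · exact (𝒰.f i).isOpenEmbedding.isOpenMap _ (h𝒰 i)
  · exact ⟨q, (map_fromSpecResidueField_mem_iff_of_isIso P x (𝒰.f i) q).mpr hp, rfl⟩

/-- **Pointwise open conditions, `Opens`-valued form**: the data `(U, hU)` consumed by
`isOpenImmersion_presheaf_of_openCondition` / `isRepresentable_of_openCondition_cover`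
(`OpenSubfunctorCover`), for a subfunctor `P` satisfying (pt) and (refl) and any choice of opens
`U x` with the pointwise description. [cite: GortzWedhorn2020, Ch. 8 (8.4)] -/
theorem openCondition_of_pointwise
    (hpt : ∀ {T : Scheme.{u}} (y : F.obj (op T)),
      y ∈ P.obj (op T) ↔
        ∀ p : T, F.map (T.fromSpecResidueField p).op y ∈ P.obj (op (Spec (T.residueField p))))
    (hrefl : ∀ (K L : CommRingCat.{u}) (_ : IsField K) (_ : IsField L) (φ : K ⟶ L)
      (y : F.obj (op (Spec K))), F.map (Spec.map φ).op y ∈ P.obj (op (Spec L)) →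
        y ∈ P.obj (op (Spec K)))
    (U : ∀ {T : Scheme.{u}}, F.obj (op T) → T.Opens)
    (hU : ∀ {T : Scheme.{u}} (x : F.obj (op T)) (p : T),
      p ∈ U x ↔ F.map (T.fromSpecResidueField p).op x ∈ P.obj (op (Spec (T.residueField p))))
    {T T' : Scheme.{u}} (x : F.obj (op T)) (h : T' ⟶ T) :
    F.map h.op x ∈ P.obj (op T') ↔ Set.range h ⊆ (U x : Set T) :=
  map_mem_iff_range_subset_of_pointwise P hpt hrefl x (U x : Set T) (fun p => hU x p) h

/-- **Field-valued points suffice for the cover condition**: under (pt), if a family of pointwise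
subfunctors `P i` covers every field-valued point of `F`, then for every `x ∈ F(T)` the loci
`{p | x(p) ∈ P i}` cover `T`. [cite: GortzWedhorn2020, Ch. 8 (8.4)] -/
theorem iUnion_setOf_pointwise_eq_univ {ι : Type*} (P : ι → Subfunctor F)
    (hcover : ∀ (K : CommRingCat.{u}) (_ : IsField K) (y : F.obj (op (Spec K))),
      ∃ i, y ∈ (P i).obj (op (Spec K)))
    {T : Scheme.{u}} (x : F.obj (op T)) :
    ⋃ i, {p : T | F.map (T.fromSpecResidueField p).op x ∈
      (P i).obj (op (Spec (T.residueField p)))} = Set.univ := by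
  refine Set.eq_univ_of_forall fun p => ?_
  obtain ⟨i, hi⟩ := hcover (T.residueField p) (Field.toIsField _)
    (F.map (T.fromSpecResidueField p).op x)
  exact Set.mem_iUnion.mpr ⟨i, hi⟩

end Literature.AlgebraicGeometry.Motives
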